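import Mathlib
import HarnessLib
import Summits.HubbardSuperconductivity.HubbardSuperconductivity.Theorems.KLProgrammeH10TwoPointLimitSymbolProductSampled

/-!
# Route `KLProgramme` — engine support (route (L2)): the PRODUCT of two sampled symbols on the same band is a sampled symbol —
# profile `G₁G₂` (p4's `profile_mul`), angular factor `Z₁Z₂` with Leibniz data, support/cell/zone of the first factor

Cell `gate-hubbard-kl`, seat hubbard-kl-k3c2-p3; gen-4 ENGINE child stmt-HubbardSuperconductivity-19855 (`stub_engine_step_norms`, propagator
`α_n`).  The step theorem `hubbardSectorKernelNorm_effAction_le_of_sectorNorm` pulls the slice covariance back by the FAT family `Ft`, so the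
multiplier product of `slicePair_charSum_l1_le` is `M = Ft_ω·Ft_{ω′}`; the p4 lineage's sampled-symbol layer bounds ONE sampled symbol
`Φ(k₀,p) = G(k₀² + e(p)²)·Z(p)`.  This file is the bookkeeping that turns two such representations (same band `e`, scales `Λ₁ ≤ Λ₂`) into one
for the product, in exactly the hypothesis shapes of `norm_fwdDiff_two_space_sampledSymbol_le'` / `norm_fwdDiff_space_sampledSymbol_le'` /
`norm_fwdDiff_two_time_sampledSymbol_le`:

* `sampledProduct_repr` — `Φ₁Φ₂ = (G₁G₂)(k₀²+e²)·(Z₁Z₂)` and the sampled identity;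
* `contDiff_mul_angular`, `abs_mul_angular_le` — `Z₁Z₂` is `C²`, `|Z₁Z₂| ≤ z₀z₀′`;
* **`abs_deriv_mul_angular_line_le`**, **`abs_iteratedDeriv_two_mul_angular_line_le`** — the conditional line-derivative data of `Z₁Z₂`
  (`z₁z₀′ + z₀z₁′`, `z₂z₀′ + 2z₁z₁′ + z₀z₂′`) from those of the factors (conditions at the finer scale `Λ₁`);
* `mul_angular_cell` — the cell of the product is the cell of the first factor; `sampledProduct_zone` — the zone of the product from the first.

Everything is proved; no definitions, no named facts. [folklore]

References: G. Benfatto, A. Giuliani, V. Mastropietro, Ann. Henri Poincaré 7 (2006) 809–898, §2.7 (2.66), §2.8 (2.81).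
-/

noncomputable section

namespace Summit.HubbardSuperconductivity.HubbardSuperconductivity.Theorems.TorusFourierL2

set_option linter.dupNamespace false -- summit = problem name (single-conjunct summit), D-0017

open Set Finset Literature.Probability.LatticeModels
open scoped Real

/-! ### §1 The representation of the product -/

/-- **Product of two sampled symbols on the same band.** [folklore] -/
theorem sampledProduct_repr {G₁ G₂ : ℝ → ℝ} {e Z₁ Z₂ : (Fin 2 → ℝ) → ℝ} (Φ₁ Φ₂ : ℝ × (Fin 2 → ℝ) → ℂ)
    (hΦ₁ : ∀ k₀ p, Φ₁ (k₀, p) = ((G₁ (k₀ ^ 2 + e p ^ 2) * Z₁ p : ℝ) : ℂ))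
    (hΦ₂ : ∀ k₀ p, Φ₂ (k₀, p) = ((G₂ (k₀ ^ 2 + e p ^ 2) * Z₂ p : ℝ) : ℂ)) (k₀ : ℝ) (p : Fin 2 → ℝ) :
    Φ₁ (k₀, p) * Φ₂ (k₀, p) = (((fun u => G₁ u * G₂ u) (k₀ ^ 2 + e p ^ 2) * (fun p => Z₁ p * Z₂ p) p : ℝ) : ℂ) := by
  rw [hΦ₁, hΦ₂]; push_cast; ring

/-- The sampled product: if `Gs₁`, `Gs₂` sample `Φ₁`, `Φ₂`, then `Gs₁·Gs₂` samples `Φ₁Φ₂`. [folklore] -/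
theorem sampledProduct_sample {P L : ℕ} (Φ₁ Φ₂ : ℝ × (Fin 2 → ℝ) → ℂ) (a₀ h₀ hx : ℝ)
    (Gs₁ Gs₂ : TorusSite 1 P × TorusSite 2 L → ℂ)
    (hGs₁ : ∀ q, Gs₁ q = Φ₁ (a₀ + h₀ * (((q.1 0).val : ℕ) : ℝ), fun j => hx * (((q.2 j).valMinAbs : ℤ) : ℝ)))
    (hGs₂ : ∀ q, Gs₂ q = Φ₂ (a₀ + h₀ * (((q.1 0).val : ℕ) : ℝ), fun j => hx * (((q.2 j).valMinAbs : ℤ) : ℝ)))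
    (q : TorusSite 1 P × TorusSite 2 L) :
    (fun q => Gs₁ q * Gs₂ q) q =
      (fun x : ℝ × (Fin 2 → ℝ) => Φ₁ x * Φ₂ x) (a₀ + h₀ * (((q.1 0).val : ℕ) : ℝ), fun j => hx * (((q.2 j).valMinAbs : ℤ) : ℝ)) := by
  simp only [hGs₁ q, hGs₂ q]

/-- The product symbol has the sampled-symbol form with profile `G₁G₂` and angular factor `Z₁Z₂`. [folklore] -/
theorem sampledProduct_symbol {G₁ G₂ : ℝ → ℝ} {e Z₁ Z₂ : (Fin 2 → ℝ) → ℝ} (Φ₁ Φ₂ : ℝ × (Fin 2 → ℝ) → ℂ)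
    (hΦ₁ : ∀ k₀ p, Φ₁ (k₀, p) = ((G₁ (k₀ ^ 2 + e p ^ 2) * Z₁ p : ℝ) : ℂ))
    (hΦ₂ : ∀ k₀ p, Φ₂ (k₀, p) = ((G₂ (k₀ ^ 2 + e p ^ 2) * Z₂ p : ℝ) : ℂ)) :
    ∀ k₀ p, (fun x : ℝ × (Fin 2 → ℝ) => Φ₁ x * Φ₂ x) (k₀, p) =
      (((fun u => G₁ u * G₂ u) (k₀ ^ 2 + e p ^ 2) * (fun p => Z₁ p * Z₂ p) p : ℝ) : ℂ) :=
  fun k₀ p => sampledProduct_repr Φ₁ Φ₂ hΦ₁ hΦ₂ k₀ p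

/-! ### §2 The angular factor of the product -/

/-- `Z₁Z₂` is `C²`. [folklore] -/
theorem contDiff_mul_angular {Z₁ Z₂ : (Fin 2 → ℝ) → ℝ} (h₁ : ContDiff ℝ 2 Z₁) (h₂ : ContDiff ℝ 2 Z₂) :
    ContDiff ℝ 2 fun p => Z₁ p * Z₂ p := h₁.mul h₂

/-- `|Z₁Z₂| ≤ z₀z₀′`. [folklore] -/
theorem abs_mul_angular_le {Z₁ Z₂ : (Fin 2 → ℝ) → ℝ} {z₀ z₀' : ℝ} (h₁ : ∀ p, |Z₁ p| ≤ z₀) (h₂ : ∀ p, |Z₂ p| ≤ z₀') (p : Fin 2 → ℝ) :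
    |Z₁ p * Z₂ p| ≤ z₀ * z₀' := by
  rw [abs_mul]
  exact mul_le_mul (h₁ p) (h₂ p) (abs_nonneg _) ((abs_nonneg _).trans (h₁ p))

/-- **First line derivative of `Z₁Z₂`** (conditional form, conditions at the finer scale `Λ₁ ≤ Λ₂`):
`|∂ₛ(Z₁Z₂)(p₀ + s w)| ≤ z₁z₀′ + z₀z₁′`. [folklore] -/
theorem abs_deriv_mul_angular_line_le {e Z₁ Z₂ : (Fin 2 → ℝ) → ℝ} (h₁ : ContDiff ℝ 2 Z₁) (h₂ : ContDiff ℝ 2 Z₂)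
    {Λ₁ Λ₂ zm z₀ z₀' z₁ z₁' : ℝ} (hΛ : Λ₁ ≤ Λ₂) (hZ0 : ∀ p, |Z₁ p| ≤ z₀) (hZ0' : ∀ p, |Z₂ p| ≤ z₀') (w : Fin 2 → ℝ)
    (hZ1 : ∀ (p₀ : Fin 2 → ℝ) (s : ℝ), (∀ i, |(p₀ + s • w) i| ≤ π + zm) → |e (p₀ + s • w)| ≤ Λ₁ →
      |deriv (fun s : ℝ => Z₁ (p₀ + s • w)) s| ≤ z₁)
    (hZ1' : ∀ (p₀ : Fin 2 → ℝ) (s : ℝ), (∀ i, |(p₀ + s • w) i| ≤ π + zm) → |e (p₀ + s • w)| ≤ Λ₂ →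
      |deriv (fun s : ℝ => Z₂ (p₀ + s • w)) s| ≤ z₁')
    (p₀ : Fin 2 → ℝ) (s : ℝ) (hsq : ∀ i, |(p₀ + s • w) i| ≤ π + zm) (hes : |e (p₀ + s • w)| ≤ Λ₁) :
    |deriv (fun s : ℝ => Z₁ (p₀ + s • w) * Z₂ (p₀ + s • w)) s| ≤ z₁ * z₀' + z₀ * z₁' := by
  have hl : ContDiff ℝ 2 fun s : ℝ => p₀ + s • w := contDiff_const.add (contDiff_id.smul contDiff_const)
  have hA : ContDiff ℝ 2 fun s : ℝ => Z₁ (p₀ + s • w) := h₁.comp hl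
  have hB : ContDiff ℝ 2 fun s : ℝ => Z₂ (p₀ + s • w) := h₂.comp hl
  rw [deriv_mul₂ hA hB s]
  have h1 := hZ1 p₀ s hsq hes
  have h2 := hZ1' p₀ s hsq (hes.trans hΛ)
  have h3 := hZ0 (p₀ + s • w)
  have h4 := hZ0' (p₀ + s • w)
  have hz0 : 0 ≤ z₀ := (abs_nonneg _).trans h3
  have hz1' : 0 ≤ z₁' := (abs_nonneg _).trans h2
  calc _ ≤ |deriv (fun s : ℝ => Z₁ (p₀ + s • w)) s * Z₂ (p₀ + s • w)| + |Z₁ (p₀ + s • w) * deriv (fun s : ℝ => Z₂ (p₀ + s • w)) s| :=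
        abs_add_le _ _
    _ ≤ z₁ * z₀' + z₀ * z₁' := by
        rw [abs_mul, abs_mul]
        exact add_le_add (mul_le_mul h1 h4 (abs_nonneg _) ((abs_nonneg _).trans h1))
          (mul_le_mul h3 h2 (abs_nonneg _) hz0)

/-- **Second line derivative of `Z₁Z₂`** (conditional form): `|∂ₛ²(Z₁Z₂)(p₀ + s w)| ≤ z₂z₀′ + 2z₁z₁′ + z₀z₂′`. [folklore] -/
theorem abs_iteratedDeriv_two_mul_angular_line_le {e Z₁ Z₂ : (Fin 2 → ℝ) → ℝ} (h₁ : ContDiff ℝ 2 Z₁) (h₂ : ContDiff ℝ 2 Z₂)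
    {Λ₁ Λ₂ zm z₀ z₀' z₁ z₁' z₂ z₂' : ℝ} (hΛ : Λ₁ ≤ Λ₂) (hZ0 : ∀ p, |Z₁ p| ≤ z₀) (hZ0' : ∀ p, |Z₂ p| ≤ z₀') (w : Fin 2 → ℝ)
    (hZ1 : ∀ (p₀ : Fin 2 → ℝ) (s : ℝ), (∀ i, |(p₀ + s • w) i| ≤ π + zm) → |e (p₀ + s • w)| ≤ Λ₁ →
      |deriv (fun s : ℝ => Z₁ (p₀ + s • w)) s| ≤ z₁)
    (hZ1' : ∀ (p₀ : Fin 2 → ℝ) (s : ℝ), (∀ i, |(p₀ + s • w) i| ≤ π + zm) → |e (p₀ + s • w)| ≤ Λ₂ →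
      |deriv (fun s : ℝ => Z₂ (p₀ + s • w)) s| ≤ z₁')
    (hZ2 : ∀ (p₀ : Fin 2 → ℝ) (s : ℝ), (∀ i, |(p₀ + s • w) i| ≤ π + zm) → |e (p₀ + s • w)| ≤ Λ₁ →
      |iteratedDeriv 2 (fun s : ℝ => Z₁ (p₀ + s • w)) s| ≤ z₂)
    (hZ2' : ∀ (p₀ : Fin 2 → ℝ) (s : ℝ), (∀ i, |(p₀ + s • w) i| ≤ π + zm) → |e (p₀ + s • w)| ≤ Λ₂ →
      |iteratedDeriv 2 (fun s : ℝ => Z₂ (p₀ + s • w)) s| ≤ z₂')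
    (p₀ : Fin 2 → ℝ) (s : ℝ) (hsq : ∀ i, |(p₀ + s • w) i| ≤ π + zm) (hes : |e (p₀ + s • w)| ≤ Λ₁) :
    |iteratedDeriv 2 (fun s : ℝ => Z₁ (p₀ + s • w) * Z₂ (p₀ + s • w)) s| ≤ z₂ * z₀' + 2 * (z₁ * z₁') + z₀ * z₂' := by
  have hl : ContDiff ℝ 2 fun s : ℝ => p₀ + s • w := contDiff_const.add (contDiff_id.smul contDiff_const)
  have hA : ContDiff ℝ 2 fun s : ℝ => Z₁ (p₀ + s • w) := h₁.comp hl
  have hB : ContDiff ℝ 2 fun s : ℝ => Z₂ (p₀ + s • w) := h₂.comp hl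
  rw [iteratedDeriv_two_mul₂ hA hB s]
  have h1 := hZ1 p₀ s hsq hes
  have h2 := hZ1' p₀ s hsq (hes.trans hΛ)
  have h3 := hZ0 (p₀ + s • w)
  have h4 := hZ0' (p₀ + s • w)
  have h5 := hZ2 p₀ s hsq hes
  have h6 := hZ2' p₀ s hsq (hes.trans hΛ)
  have hz0 : 0 ≤ z₀ := (abs_nonneg _).trans h3
  have hz0' : 0 ≤ z₀' := (abs_nonneg _).trans h4
  have hz1 : 0 ≤ z₁ := (abs_nonneg _).trans h1
  calc _ ≤ |iteratedDeriv 2 (fun s : ℝ => Z₁ (p₀ + s • w)) s * Z₂ (p₀ + s • w)| +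
        |2 * (deriv (fun s : ℝ => Z₁ (p₀ + s • w)) s * deriv (fun s : ℝ => Z₂ (p₀ + s • w)) s)| +
        |Z₁ (p₀ + s • w) * iteratedDeriv 2 (fun s : ℝ => Z₂ (p₀ + s • w)) s| := abs_add_three _ _ _
    _ ≤ z₂ * z₀' + 2 * (z₁ * z₁') + z₀ * z₂' := by
        rw [abs_mul, abs_mul, abs_mul, abs_mul, abs_two]
        refine add_le_add (add_le_add ?_ ?_) ?_
        · exact mul_le_mul h5 h4 (abs_nonneg _) ((abs_nonneg _).trans h5)
        · exact mul_le_mul_of_nonneg_left (mul_le_mul h1 h2 (abs_nonneg _) hz1) (by norm_num)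
        · exact mul_le_mul h3 h6 (abs_nonneg _) hz0

/-! ### §3 Cell and zone of the product -/

/-- **The cell of the product is the cell of the first factor.** [folklore] -/
theorem mul_angular_cell {e Z₁ Z₂ : (Fin 2 → ℝ) → ℝ} {Λ₁ zm ρ : ℝ} {pF : Fin 2 → ℝ}
    (hcell : ∀ p : Fin 2 → ℝ, (∀ i, |p i| ≤ π + zm) → |e p| ≤ Λ₁ → Z₁ p ≠ 0 → ‖p - pF‖ ≤ ρ) :
    ∀ p : Fin 2 → ℝ, (∀ i, |p i| ≤ π + zm) → |e p| ≤ Λ₁ → Z₁ p * Z₂ p ≠ 0 → ‖p - pF‖ ≤ ρ :=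
  fun p hsq he hZ => hcell p hsq he (mul_ne_zero_iff.1 hZ).1

/-- **The zone of the product from the zone of the first factor.** [folklore] -/
theorem sampledProduct_zone (Φ₁ Φ₂ : ℝ × (Fin 2 → ℝ) → ℂ) {zm : ℝ}
    (hzoneΦ : ∀ (k₀ : ℝ) (p : Fin 2 → ℝ), (∃ j, π - zm ≤ |p j|) → Φ₁ (k₀, p) = 0) :
    ∀ (k₀ : ℝ) (p : Fin 2 → ℝ), (∃ j, π - zm ≤ |p j|) → (fun x : ℝ × (Fin 2 → ℝ) => Φ₁ x * Φ₂ x) (k₀, p) = 0 :=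
  fun k₀ p h => by simp only [hzoneΦ k₀ p h, zero_mul]

/-- **The support count of the product is at most that of the first factor.** [folklore] -/
theorem card_support_mul_le_left {ι : Type*} [Fintype ι] [DecidableEq ι] (f g : ι → ℂ) :
    (univ.filter fun q => f q * g q ≠ 0).card ≤ (univ.filter fun q => f q ≠ 0).card :=
  card_le_card (fun q hq => by
    rw [mem_filter] at hq ⊢
    exact ⟨hq.1, (mul_ne_zero_iff.1 hq.2).1⟩)

end Summit.HubbardSuperconductivity.HubbardSuperconductivity.Theorems.TorusFourierL2

end
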